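import Mathlib
import HarnessLib
import Literature.Geometry.DiscreteGeometry.ConvexHullFacets

/-!
# Soft four-rings, endgame groundwork: a facet is determined by three of its tight points

Support file for `SoftFourRings` (route `PricedLinkCensus`, sub-problem `Crystallization`),
first brick of the endgame (E) (identification of the bond graph once `no_slack_one_percent`
holds): for a finite set `X` of unit vectors of `ℝ³`,

* `linearIndependent_of_tight_three` : three distinct unit vectors on a plane `⟪c, ·⟫ = 1` are
  linearly independent (a line meets the unit sphere in at most two points);
* `facetNormal_eq_of_three_common` : two facet normals of `conv X` whose tight sets share three
  distinct points are equal.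
-/

namespace Summit.AtomisticToContinuum.Crystallization.Theorems

open Real RealInnerProductSpace Literature.Geometry.DiscreteGeometry

/-- **Strict convexity of the sphere, affine form**: if `a • y₁ + b • y₂ = (a + b) • y₃` for unit
vectors with `y₃ ≠ y₁`, `y₃ ≠ y₂`, `y₁ ≠ y₂`, then `a = 0` and `b = 0`. -/
theorem eq_zero_of_affine_combination_unit {y₁ y₂ y₃ : EuclideanSpace ℝ (Fin 3)}
    (h1 : ‖y₁‖ = 1) (h2 : ‖y₂‖ = 1) (h3 : ‖y₃‖ = 1) (h12 : y₁ ≠ y₂) (h13 : y₁ ≠ y₃)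
    (h23 : y₂ ≠ y₃) {a b : ℝ} (h : a • y₁ + b • y₂ = (a + b) • y₃) : a = 0 ∧ b = 0 := by
  -- inner products of distinct unit vectors are `< 1`
  have hlt : ∀ {u v : EuclideanSpace ℝ (Fin 3)}, ‖u‖ = 1 → ‖v‖ = 1 → u ≠ v → ⟪u, v⟫ < 1 := by
    intro u v hu hv huv
    have hle : ⟪u, v⟫ ≤ 1 := by
      have := real_inner_le_norm u v; rw [hu, hv, mul_one] at this; exact this
    refine lt_of_le_of_ne hle fun heq => huv ?_
    have : ‖u - v‖ ^ 2 = 0 := by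
      rw [norm_sub_sq_real, hu, hv, heq]; ring
    exact sub_eq_zero.1 (norm_eq_zero.1 (pow_eq_zero_iff two_ne_zero |>.1 this))
  by_cases hab : a + b = 0
  · have hb : b = -a := by linarith
    rw [hab, zero_smul, hb, neg_smul, ← sub_eq_add_neg, ← smul_sub, smul_eq_zero] at h
    rcases h with h | h
    · exact ⟨h, by rw [hb, h, neg_zero]⟩
    · exact absurd (sub_eq_zero.1 h) h12
  · -- `y₃` is on the line through `y₁, y₂`: `y₃ = t y₁ + (1 - t) y₂`, `t = a/(a+b)`
    exfalso
    set t : ℝ := a / (a + b) with ht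
    have hy3 : y₃ = t • y₁ + (1 - t) • y₂ := by
      have h' := congrArg (fun z => (a + b)⁻¹ • z) h
      simp only [smul_add, smul_smul, inv_mul_cancel₀ hab, one_smul] at h'
      rw [← h', ht]
      congr 1
      · rw [div_eq_inv_mul]
      · rw [show 1 - a / (a + b) = (a + b)⁻¹ * b by field_simp; ring]
    -- `‖y₃‖² = 1 - 2 t (1 - t) (1 - ⟪y₁, y₂⟫)`
    have hsq : ‖y₃‖ ^ 2 = 1 - 2 * t * (1 - t) * (1 - ⟪y₁, y₂⟫) := by
      rw [hy3, norm_add_sq_real, norm_smul, norm_smul, h1, h2, mul_one, mul_one,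
        real_inner_smul_left, real_inner_smul_right, Real.norm_eq_abs, Real.norm_eq_abs,
        sq_abs, sq_abs]
      ring
    rw [h3, one_pow] at hsq
    have h12' := hlt h1 h2 h12
    have htt : t * (1 - t) = 0 := by nlinarith
    rcases mul_eq_zero.1 htt with h0 | h0
    · -- `t = 0`: `y₃ = y₂`
      rw [h0, zero_smul, zero_add, sub_zero, one_smul] at hy3
      exact h23 hy3.symm
    · -- `t = 1`: `y₃ = y₁`
      have : t = 1 := by linarith
      rw [this, one_smul, sub_self, zero_smul, add_zero] at hy3
      exact h13 hy3.symm

/-- **Three distinct unit vectors on a plane `⟪c, ·⟫ = 1` are linearly independent.** -/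
theorem linearIndependent_of_tight_three {c y₁ y₂ y₃ : EuclideanSpace ℝ (Fin 3)}
    (h1 : ‖y₁‖ = 1) (h2 : ‖y₂‖ = 1) (h3 : ‖y₃‖ = 1) (hc1 : ⟪c, y₁⟫ = 1) (hc2 : ⟪c, y₂⟫ = 1)
    (hc3 : ⟪c, y₃⟫ = 1) (h12 : y₁ ≠ y₂) (h13 : y₁ ≠ y₃) (h23 : y₂ ≠ y₃) :
    LinearIndependent ℝ ![y₁, y₂, y₃] := by
  rw [Fintype.linearIndependent_iff]
  intro g hg
  simp only [Fin.sum_univ_three, Matrix.cons_val_zero, Matrix.cons_val_one,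
    Matrix.cons_val] at hg
  -- apply `⟪c, ·⟫`: the coefficients sum to `0`
  have hsum : g 0 + g 1 + g 2 = 0 := by
    have := congrArg (fun z => ⟪c, z⟫) hg
    simp only [inner_add_right, real_inner_smul_right, hc1, hc2, hc3, inner_zero_right,
      mul_one] at this
    exact this
  have h' : g 0 • y₁ + g 1 • y₂ = (g 0 + g 1) • y₃ := by
    have : g 2 = -(g 0 + g 1) := by linarith
    rw [this, neg_smul, ← sub_eq_add_neg, sub_eq_zero] at hg
    exact hg
  obtain ⟨ha, hb⟩ := eq_zero_of_affine_combination_unit h1 h2 h3 h12 h13 h23 h'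
  intro i
  fin_cases i
  · exact ha
  · exact hb
  · simp only [Fin.reduceFinMk]; linarith

/-- **A facet normal is determined by three of its tight points**: if `c₁, c₂ ∈ facetNormals X`
(for unit vectors `X ⊂ ℝ³`) have three distinct common tight points, then `c₁ = c₂`. -/
theorem facetNormal_eq_of_three_common {X : Finset (EuclideanSpace ℝ (Fin 3))}
    (hX1 : ∀ y ∈ X, ‖y‖ = 1) {c₁ c₂ y₁ y₂ y₃ : EuclideanSpace ℝ (Fin 3)}
    (h₁₁ : y₁ ∈ tightSet X c₁) (h₁₂ : y₂ ∈ tightSet X c₁) (h₁₃ : y₃ ∈ tightSet X c₁)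
    (h₂₁ : y₁ ∈ tightSet X c₂) (h₂₂ : y₂ ∈ tightSet X c₂) (h₂₃ : y₃ ∈ tightSet X c₂)
    (h12 : y₁ ≠ y₂) (h13 : y₁ ≠ y₃) (h23 : y₂ ≠ y₃) : c₁ = c₂ := by
  obtain ⟨hy1, hc11⟩ := mem_tightSet.1 h₁₁
  obtain ⟨hy2, hc12⟩ := mem_tightSet.1 h₁₂
  obtain ⟨hy3, hc13⟩ := mem_tightSet.1 h₁₃
  have hc21 := (mem_tightSet.1 h₂₁).2
  have hc22 := (mem_tightSet.1 h₂₂).2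
  have hc23 := (mem_tightSet.1 h₂₃).2
  have hli := linearIndependent_of_tight_three (hX1 _ hy1) (hX1 _ hy2) (hX1 _ hy3) hc11 hc12 hc13
    h12 h13 h23
  have hspan : Submodule.span ℝ (Set.range ![y₁, y₂, y₃]) = ⊤ :=
    hli.span_eq_top_of_card_eq_finrank (by simp)
  -- `c₁ - c₂` is orthogonal to the spanning family
  have horth : ∀ i, ⟪![y₁, y₂, y₃] i, c₁ - c₂⟫ = 0 := by
    intro i
    fin_cases i
    · simp [inner_sub_right, real_inner_comm, hc11, hc21]
    · simp [inner_sub_right, real_inner_comm, hc12, hc22]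
    · simp [inner_sub_right, real_inner_comm, hc13, hc23]
  have hmem : c₁ - c₂ ∈ (Submodule.span ℝ (Set.range ![y₁, y₂, y₃]))ᗮ := by
    rw [Submodule.mem_orthogonal]
    intro u hu
    refine Submodule.span_induction ?_ (by simp) (fun x y _ _ hx hy => ?_) (fun a x _ hx => ?_) hu
    · rintro _ ⟨i, rfl⟩; exact horth i
    · rw [inner_add_left, hx, hy, add_zero]
    · rw [real_inner_smul_left, hx, mul_zero]
  rw [hspan, Submodule.top_orthogonal_eq_bot, Submodule.mem_bot, sub_eq_zero] at hmem
  exact hmem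

end Summit.AtomisticToContinuum.Crystallization.Theorems
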